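import Summits.Parity.GeneralizedHardyLittlewood.Theses.LeeYangFibres
import Summits.Parity.GeneralizedHardyLittlewood.Theorems.LeeYangFibresCellsToRelativeDimOneCounts
import Literature.NumberTheory.Sieve.LinearEquationsInPrimesDimOne
import HarnessLib

/-!
# Crux `PrimeCellsRelative` (stmt-Parity-14112): non-degeneracy is load-bearing, whatever the
# junk value of the divergent singular product

Negative-side support (refuter cdisprove seat). `PrimeCellsRelative` quantifies over systems
satisfying Green–Tao's standing hypotheses `IsNondegenerateSystem` (non-constant forms, no two
rational multiples of each other). Here we record, sorry-free, that the second clause cannot be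
dropped: the variant WITHOUT `IsNondegenerateSystem Ψ` (stated inline below; no proposition is
defined under `Summits/`) is false for the DIAGONAL system `Ψ = (n, n)` (`t = 2`, `‖Ψ‖_N = 2`) on
`K = [-N, N]`. Its singular product `𝔖 = lim ∏_{p ≤ x} p/(p-1)` is a divergent Euler product, so
`singularProduct Ψ` is an unspecified real (`limUnder` junk); the refutation is uniform in that
value: the diagonal prime cell has `≥ A₁(N) ≍ N/log N` points, while the model is
`𝔖 · A₁(N)²/N`; for `𝔖 ≤ 0` the count alone exceeds the allowance `(𝔖 A₁²/N + N/log² N)/4`, and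
for `𝔖 > 0` the model is at most half the count once `log N > 3𝔖`, so the claimed inequality fails at
every scale `N > exp(3𝔖)`, `N ≥ 4` (prime number theorem window `N/2 ≤ A₁(N) log N ≤ 3N/2`, tree:
`eventually_primeCounting_window`).

Moral for provers: coincident (proportional) forms must be excluded by the mechanism itself —
the parity-vector model `Θ · M_j` of `CellParityLaw` has no diagonal term, and no normalisation of
`𝔖` repairs the diagonal. This file does NOT refute the crux.
-/

noncomputable section

namespace Summit.Parity.GeneralizedHardyLittlewood.Theorems.PrimeCellsRelative.Negative

open scoped BigOperators Topology Classical MeasureTheory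
open Filter Set Function MeasureTheory Finset Literature.NumberTheory.Sieve
open Summit.Parity.GeneralizedHardyLittlewood.Theorems.LeeYangFibresCells
  (card_roughPrimes_le_primeCounting primeCounting_le_card_roughPrimes_add
    eventually_primeCounting_window)

namespace Nondegeneracy

/-- The archimedean factor of the diagonal system `(n, n)` on `[-N, N]` is `N` (the positive
half of the box). [folklore] -/
theorem archFactor_diag_realBox (N : ℕ) :
    archFactor (fun _ : Fin 2 => (⟨fun _ => 1, 0⟩ : AffLinForm 1)) (realBox 1 (N : ℝ)) = N := by
  rw [DimOne.archFactor_eq]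
  have hset : {r : ℝ | (fun _ : Fin 1 => r) ∈ realBox 1 (N : ℝ) ∧
      ∀ _i : Fin 2, 0 < (⟨fun _ => 1, 0⟩ : AffLinForm 1).realEval (fun _ => r)} =
        Set.Ioc 0 (N : ℝ) := by
    ext r
    simp only [Set.mem_setOf_eq, realBox, Set.mem_Icc, Pi.le_def, DimOne.realEval_eq,
      Int.cast_one, one_mul, Int.cast_zero, add_zero, forall_const, Set.mem_Ioc]
    constructor
    · rintro ⟨⟨-, h2⟩, h3⟩
      exact ⟨h3, h2⟩
    · rintro ⟨h1, h2⟩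
      exact ⟨⟨by linarith [Nat.cast_nonneg (α := ℝ) N], h2⟩, h1⟩
  rw [hset, Real.volume_Ioc, ENNReal.toReal_ofReal (by simp)]
  simp

/-- The arithmetic heart, with the two finsets of the statement abstracted (so that the
decidability instances printed in the route file are met by unification) and the singular
product an ARBITRARY real `S`. [folklore] -/
theorem finish {N : ℕ} (hN : 4 ≤ N) {p : (Fin 1 → ℤ) → Prop} {hdec : DecidablePred p}
    {q : ℕ → Prop} {hdec' : DecidablePred q} {S β Z : ℝ}
    (hb : |(#((latticeBox 1 N).filter p) : ℝ) - β * S * ((#((Finset.Icc 1 N).filter q) : ℝ) / N) ^ 2| ≤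
      1 / 4 * (β * S * ((#((Finset.Icc 1 N).filter q) : ℝ) / N) ^ 2 + N / Real.log N ^ 2))
    (hinj : #((Finset.Icc 1 N).filter q) ≤ #((latticeBox 1 N).filter p)) (hβ : β = N)
    (hlogS : 3 * S < Real.log N)
    (hlow : (Nat.primeCounting N : ℝ) ≤ #((Finset.Icc 1 N).filter q) + Z) (hZ : Z ≤ Real.sqrt N)
    (hup : (#((Finset.Icc 1 N).filter q) : ℝ) ≤ Nat.primeCounting N)
    (hwin : ∀ A' : ℝ, (Nat.primeCounting N : ℝ) - Real.sqrt N ≤ A' → A' ≤ Nat.primeCounting N →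
      (1 - 1 / 2) * N ≤ A' * Real.log N ∧ A' * Real.log N ≤ (1 + 1 / 2) * N) : False := by
  obtain ⟨hw1, hw2⟩ := hwin _ (by linarith) hup
  rw [hβ] at hb
  set a : ℝ := (#((Finset.Icc 1 N).filter q) : ℝ) with ha
  set C : ℝ := (#((latticeBox 1 N).filter p) : ℝ) with hC
  set L : ℝ := Real.log N with hL
  set n : ℝ := (N : ℝ) with hn
  have haC : a ≤ C := by rw [ha, hC]; exact_mod_cast hinj
  have ha0 : 0 ≤ a := by rw [ha]; exact Nat.cast_nonneg _
  have hn0 : (0 : ℝ) < n := by rw [hn]; exact_mod_cast (show 0 < N by omega)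
  have hL43 : 4 / 3 < L := by
    have h4 : Real.log 4 ≤ L := by
      rw [hL, hn]
      exact Real.log_le_log (by norm_num) (by exact_mod_cast hN)
    have h2 : Real.log 4 = 2 * Real.log 2 := by
      rw [show (4 : ℝ) = 2 ^ 2 by norm_num, Real.log_pow]; norm_num
    linarith [Real.log_two_gt_d9]
  have hL0 : 0 < L := by linarith
  -- the model term `n · S · (a/n)² = S a²/n` is at most `a/2`
  have e : n * S * (a / n) ^ 2 = S * a ^ 2 / n := by field_simp
  rw [e] at hb
  have hM : S * a ^ 2 / n ≤ a / 2 := by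
    rcases le_or_gt S 0 with hS | hS
    · have : S * a ^ 2 / n ≤ 0 :=
        div_nonpos_iff.mpr (Or.inr ⟨mul_nonpos_of_nonpos_of_nonneg hS (sq_nonneg a), hn0.le⟩)
      linarith
    · rw [div_le_iff₀ hn0]
      have i1 : S * a ^ 2 ≤ L / 3 * a ^ 2 := mul_le_mul_of_nonneg_right (by linarith) (sq_nonneg a)
      have i2 : L / 3 * a ^ 2 = (a * L) * (a / 3) := by ring
      have i3 : (a * L) * (a / 3) ≤ (3 / 2 * n) * (a / 3) :=
        mul_le_mul_of_nonneg_right (by linarith) (by positivity)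
      have i4 : (3 / 2 * n) * (a / 3) = a / 2 * n := by ring
      linarith
  -- the count is at least `a > (2/3) n / L²`
  have hY : 2 / 3 * (n / L ^ 2) < a := by
    rw [show (2 : ℝ) / 3 * (n / L ^ 2) = (2 * n / 3) / L ^ 2 by ring, div_lt_iff₀ (by positivity)]
    have j1 : n / 2 * L ≤ a * L * L := mul_le_mul_of_nonneg_right (by linarith) hL0.le
    have j2 : n / 2 * (4 / 3) < n / 2 * L := mul_lt_mul_of_pos_left hL43 (by positivity)
    have j3 : a * L ^ 2 = a * L * L := by ring
    linarith
  -- linear finish: `a/2 ≤ C − M ≤ (M + n/L²)/4 ≤ (a/2 + n/L²)/4`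
  have h4 : C - S * a ^ 2 / n ≤ 1 / 4 * (S * a ^ 2 / n + n / L ^ 2) := (abs_le.mp hb).2
  linarith

end Nondegeneracy

open Nondegeneracy in
/-- **The non-degeneracy hypothesis of `PrimeCellsRelative` cannot be dropped.** Without
`IsNondegenerateSystem Ψ`, the diagonal system `Ψ = (n, n)` (`t = 2`, `L = 2`, `K = [-N, N]`,
`β_∞ = N`) is a counterexample for EVERY real value `𝔖` of its (divergent, hence junk) singular
product: the diagonal prime cell contains the `A₁(N)` rough primes themselves, and with `ε = 1/4`
the claimed `|C − 𝔖 A₁²/N| ≤ (𝔖 A₁²/N + N/log² N)/4`, `C ≥ A₁(N)`, contradicts the prime number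
theorem window `N/2 ≤ A₁(N) log N ≤ 3N/2` once `log N > max(3𝔖, 4/3)`. [folklore] -/
theorem primeCellsRelative_false_without_nondegeneracy :
    ¬ (∀ (t L : ℕ), 1 ≤ t → ∀ ε : ℝ, 0 < ε → ∃ u : ℕ, 2 ≤ u ∧ ∃ N₀ : ℕ, ∀ N : ℕ, N₀ ≤ N →
      ∀ Ψ : Fin t → Literature.NumberTheory.Sieve.AffLinForm 1,
        Literature.NumberTheory.Sieve.affLinSize Ψ N ≤ L →
        ∀ K : Set (Fin 1 → ℝ), Convex ℝ K → K ⊆ Literature.NumberTheory.Sieve.realBox 1 N →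
          |((((Literature.NumberTheory.Sieve.latticeBox 1 N).filter (fun n =>
              Literature.NumberTheory.Sieve.realPoint n ∈ K ∧ ∀ i, (N : ℝ) ^ ((1 : ℝ) / u) <
                (Nat.minFac ((Ψ i).eval n).toNat : ℝ) ∧
                ArithmeticFunction.cardFactors ((Ψ i).eval n).toNat = 1)).card : ℕ) : ℝ) -
            Literature.NumberTheory.Sieve.archFactor Ψ K *
              Literature.NumberTheory.Sieve.singularProduct Ψ *
              (((((Finset.Icc 1 N).filter (fun m => (N : ℝ) ^ ((1 : ℝ) / u) < (Nat.minFac m : ℝ) ∧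
                ArithmeticFunction.cardFactors m = 1)).card : ℕ) : ℝ) / N) ^ t| ≤
          ε * (Literature.NumberTheory.Sieve.archFactor Ψ K *
              Literature.NumberTheory.Sieve.singularProduct Ψ *
              (((((Finset.Icc 1 N).filter (fun m => (N : ℝ) ^ ((1 : ℝ) / u) < (Nat.minFac m : ℝ) ∧
                ArithmeticFunction.cardFactors m = 1)).card : ℕ) : ℝ) / N) ^ t + N / Real.log N ^ t)) := by
  intro h
  obtain ⟨u, hu2, N₀, hN₀⟩ := h 2 2 (by norm_num) (1 / 4) (by norm_num)
  obtain ⟨N₁, hN₁⟩ := Filter.eventually_atTop.mp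
    (eventually_primeCounting_window (η := 1 / 2) (by norm_num))
  -- the diagonal system and the junk value of its singular product
  set Ψ : Fin 2 → AffLinForm 1 := fun _ => ⟨fun _ => 1, 0⟩ with hΨ
  set S : ℝ := singularProduct Ψ with hS
  -- the scale
  set N : ℕ := max (max N₀ N₁) (max 4 (⌈Real.exp (3 * S)⌉₊ + 1)) with hNdef
  have hN₀N : N₀ ≤ N := (le_max_left _ _).trans (le_max_left _ _)
  have hN₁N : N₁ ≤ N := (le_max_right _ _).trans (le_max_left _ _)
  have hN4 : 4 ≤ N := (le_max_left _ _).trans (le_max_right _ _)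
  have hNexp : ⌈Real.exp (3 * S)⌉₊ + 1 ≤ N := (le_max_right _ _).trans (le_max_right _ _)
  have hlogS : 3 * S < Real.log N := by
    rw [Real.lt_log_iff_exp_lt (by exact_mod_cast (show 0 < N by omega))]
    have h1 : Real.exp (3 * S) ≤ ⌈Real.exp (3 * S)⌉₊ := Nat.le_ceil _
    have h2 : ((⌈Real.exp (3 * S)⌉₊ + 1 : ℕ) : ℝ) ≤ N := by exact_mod_cast hNexp
    push_cast at h2
    linarith
  have hb := hN₀ N hN₀N Ψ ?_ (realBox 1 N) (convex_Icc _ _) subset_rfl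
  · refine finish hN4 hb ?_ (archFactor_diag_realBox N) hlogS
      (primeCounting_le_card_roughPrimes_add N (Real.rpow_nonneg (Nat.cast_nonneg N) _)) ?_
      (card_roughPrimes_le_primeCounting N _) (hN₁ N hN₁N)
    · -- the rough primes `m` themselves are diagonal prime points `(m, m)`
      refine Finset.card_le_card_of_injOn (fun m : ℕ => fun _ : Fin 1 => (m : ℤ)) ?_ ?_
      · intro m hm
        simp only [Finset.coe_filter, Set.mem_setOf_eq, Finset.mem_Icc] at hm
        obtain ⟨⟨hm1, hmN⟩, hmZ, hmΩ⟩ := hm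
        simp only [Finset.coe_filter, Set.mem_setOf_eq]
        refine ⟨?_, ?_, fun _ => ?_⟩
        · unfold Literature.NumberTheory.Sieve.latticeBox
          rw [Fintype.mem_piFinset]
          intro _
          rw [Finset.mem_Icc]
          constructor <;> omega
        · simp only [Literature.NumberTheory.Sieve.realPoint, Literature.NumberTheory.Sieve.realBox,
            Set.mem_Icc, Pi.le_def, Int.cast_natCast]
          have h1 : (m : ℝ) ≤ (N : ℝ) := by exact_mod_cast hmN
          have h2 : (0 : ℝ) ≤ m := Nat.cast_nonneg m
          exact ⟨fun _ => by linarith, fun _ => h1⟩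
        · rw [hΨ, DimOne.eval_eq]
          simpa using And.intro hmZ hmΩ
      · intro m₁ _ m₂ _ h12
        have h0 := congr_fun h12 0
        simp only [Int.natCast_inj] at h0
        exact h0
    · -- `N^{1/u} ≤ √N`
      have hN1 : (1 : ℝ) ≤ (N : ℝ) := by exact_mod_cast (show 1 ≤ N by omega)
      have hu : (1 : ℝ) / u ≤ 1 / 2 := by
        gcongr
        exact_mod_cast hu2
      calc (N : ℝ) ^ ((1 : ℝ) / u) ≤ (N : ℝ) ^ ((1 : ℝ) / 2) := Real.rpow_le_rpow_of_exponent_le hN1 hu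
        _ = Real.sqrt N := by rw [Real.sqrt_eq_rpow]
  · -- size `‖(n, n)‖_N = 2`
    simp [Literature.NumberTheory.Sieve.affLinSize, hΨ]

end Summit.Parity.GeneralizedHardyLittlewood.Theorems.PrimeCellsRelative.Negative

end
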